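import Summits.AtomisticToContinuum.HydrodynamicLimit.Theses.InformationPercolationEngine

/-!
# Negative lemma for crux `PercolationClosesChaos` (stmt-AtomisticToContinuum-13914):
single-sphere contraction is not load-bearing — the keep(`p`)/swap(`1 − p`) family

Small-model facts supporting the standing disproof record
(`Cruxes/PercolationClosesChaos/Disproof.lean`, findings F3/F5) of the crux
`PercolationClosesChaos : KickIsotropyInfo → SpectralContractionR → ContactChaos`.

The crux's spectral hypothesis `SpectralContractionR` constrains only the SAME-sphere one-collision
operator `K f(v) = E[f(v′) | v]`. A collision vertex of the collision DAG has two out-edges, and a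
lineage census weighs a step by `K` (stay on the sphere) or by the CROSS operator
`K̃ f(v) = E[f(w′) | v]` (cross to the partner); the sign-blind dilution parameter per generation is
`ρ(K) + ρ(K̃)`. The finite family below — keep the ordered velocity pair with probability `p`, swap it
with probability `1 − p`, partner independent and uniform on `Fin n` — has, on mean-zero `f`,
`K = p · id` and `K̃ = (1 − p) · id`: the shape of `SpectralContractionR` holds with ANY constant
`c = p² > 0` (`kspK_sq`) and even `2ρ(K) = 2p < 1` (`kspK_form`), while `ρ(K) + ρ(K̃) = 1`
(`kspK_add_kspKx_form`, critical), the joint-parent χ²-ratio is `p² + (1 − p)² ≥ 1/2`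
(`kspJoint_sq`, `half_le_jointCoeff`), and the dynamics forgets nothing (`kspRun_perm`). Hence no
hypothesis on `K` alone can drive the dilution step of the engine (`exists_ksp_below`); for hard
spheres `K̃ = K` (isotropic centre-of-mass scattering), which is extra input, not a consequence of
`SpectralContractionR`.

No statement of the route is asserted here, positively or negatively.
-/

namespace Summit.AtomisticToContinuum.HydrodynamicLimit.Theorems.PercolationClosesChaos.Negative

open scoped BigOperators

/-! ## Zero forgetting of keep/swap dynamics -/

section Run

variable {α : Type*}

/-- One keep-or-swap kick on an ordered pair of velocities (`true` = keep). [folklore] -/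
def kspPair (keep : Bool) (q : α × α) : α × α := if keep then q else q.swap

/-- A run of keep-or-swap kicks driven by a bit string (the coin outcomes, of any bias). [folklore] -/
def kspRun : List Bool → α × α → α × α
  | [], q => q
  | b :: bs, q => kspRun bs (kspPair b q)

/-- **Zero forgetting**: after any kick history the pair is the initial pair or its swap — the initial
velocities are transmitted exactly, for ever, whatever the coin bias. [folklore] -/
theorem kspRun_perm (bs : List Bool) (q : α × α) : kspRun bs q = q ∨ kspRun bs q = q.swap := by
  induction bs generalizing q with
  | nil => exact Or.inl rfl
  | cons b bs ih =>
    cases b with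
    | true => simpa [kspRun, kspPair] using ih q
    | false =>
      rcases ih q.swap with h | h
      · right; simpa [kspRun, kspPair] using h
      · left; simpa [kspRun, kspPair, Prod.swap_swap] using h

end Run

/-! ## The same-sphere operator `K`, the cross operator `K̃`, and the joint-parent ratio -/

section Operators

variable {n : ℕ}

/-- SAME-sphere operator of the keep(`p`)/swap(`1 − p`) channel with an independent uniform partner:
`(K_p f)(v) = p f(v) + (1 − p) · mean f`. [folklore] -/
def kspK (p : ℚ) (f : Fin n → ℚ) (v : Fin n) : ℚ := p * f v + (1 - p) * ((∑ w, f w) / n)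

/-- CROSS operator `(K̃_p f)(v) = E[f(w′) | v]`: the partner keeps its own velocity with probability
`p` and receives `v` with probability `1 − p`. [folklore] -/
def kspKx (p : ℚ) (f : Fin n → ℚ) (v : Fin n) : ℚ := p * ((∑ w, f w) / n) + (1 - p) * f v

/-- On mean-zero functions `K_p = p · id`. [folklore] -/
theorem kspK_of_meanZero {p : ℚ} {f : Fin n → ℚ} (hf : ∑ w, f w = 0) (v : Fin n) :
    kspK p f v = p * f v := by
  simp [kspK, hf]

/-- On mean-zero functions `K̃_p = (1 − p) · id`. [folklore] -/
theorem kspKx_of_meanZero {p : ℚ} {f : Fin n → ℚ} (hf : ∑ w, f w = 0) (v : Fin n) :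
    kspKx p f v = (1 - p) * f v := by
  simp [kspKx, hf]

/-- The route's currency: `‖K_p f‖² = p² ‖f‖²` on mean-zero `f` — the shape of
`SpectralContractionR` with the constant `c = p²`, as small as desired. [folklore] -/
theorem kspK_sq {p : ℚ} {f : Fin n → ℚ} (hf : ∑ w, f w = 0) :
    ∑ v, kspK p f v ^ 2 = p ^ 2 * ∑ v, f v ^ 2 := by
  simp_rw [kspK_of_meanZero hf, Finset.mul_sum]
  refine Finset.sum_congr rfl fun v _ => ?_
  ring

/-- Single-sphere Rayleigh quotient: `⟨K_p f, f⟩ = p ‖f‖²`, i.e. `ρ(K_p) = p`. [folklore] -/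
theorem kspK_form {p : ℚ} {f : Fin n → ℚ} (hf : ∑ w, f w = 0) :
    ∑ v, kspK p f v * f v = p * ∑ v, f v ^ 2 := by
  simp_rw [kspK_of_meanZero hf, Finset.mul_sum]
  refine Finset.sum_congr rfl fun v _ => ?_
  ring

/-- Cross Rayleigh quotient: `⟨K̃_p f, f⟩ = (1 − p) ‖f‖²`, i.e. `ρ(K̃_p) = 1 − p`. [folklore] -/
theorem kspKx_form {p : ℚ} {f : Fin n → ℚ} (hf : ∑ w, f w = 0) :
    ∑ v, kspKx p f v * f v = (1 - p) * ∑ v, f v ^ 2 := by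
  simp_rw [kspKx_of_meanZero hf, Finset.mul_sum]
  refine Finset.sum_congr rfl fun v _ => ?_
  ring

/-- **`ρ(K) + ρ(K̃) = 1` for every `p`: critical**, consistent with `kspRun_perm`. [folklore] -/
theorem kspK_add_kspKx_form {p : ℚ} {f : Fin n → ℚ} (hf : ∑ w, f w = 0) :
    ∑ v, kspK p f v * f v + ∑ v, kspKx p f v * f v = ∑ v, f v ^ 2 := by
  rw [kspK_form hf, kspKx_form hf]
  ring

/-- Joint-parent conditional expectation `E[f(V′) | V = v, W = w] = p f(v) + (1 − p) f(w)`. [folklore] -/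
def kspJoint (p : ℚ) (f : Fin n → ℚ) (v w : Fin n) : ℚ := p * f v + (1 - p) * f w

/-- Second moment of the joint-parent conditional expectation under independent uniform parents
(unnormalised): `Σ_v Σ_w (p f(v) + (1 − p) f(w))² = (p² + (1 − p)²) · n · Σ f²` for mean-zero `f`.
[folklore] -/
theorem kspJoint_sq {p : ℚ} {f : Fin n → ℚ} (hf : ∑ w, f w = 0) :
    ∑ v, ∑ w, kspJoint p f v w ^ 2 = (p ^ 2 + (1 - p) ^ 2) * ((n : ℚ) * ∑ v, f v ^ 2) := by
  have hrow : ∀ v, ∑ w, kspJoint p f v w ^ 2 =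
      (n : ℚ) * (p ^ 2 * f v ^ 2) + (1 - p) ^ 2 * ∑ w, f w ^ 2 := by
    intro v
    have h1 : ∀ w, kspJoint p f v w ^ 2 =
        p ^ 2 * f v ^ 2 + ((1 - p) ^ 2 * f w ^ 2 + (2 * p * (1 - p) * f v) * f w) := by
      intro w; unfold kspJoint; ring
    rw [Finset.sum_congr rfl fun w _ => h1 w, Finset.sum_add_distrib, Finset.sum_add_distrib,
      Finset.sum_const, Finset.card_univ, Fintype.card_fin, nsmul_eq_mul, ← Finset.mul_sum,
      ← Finset.mul_sum, hf, mul_zero, add_zero]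
  rw [Finset.sum_congr rfl fun v _ => hrow v, Finset.sum_add_distrib, ← Finset.mul_sum,
    ← Finset.mul_sum, Finset.sum_const, Finset.card_univ, Fintype.card_fin, nsmul_eq_mul]
  ring

/-- The joint-parent ratio is `≥ 1/2` (the binary-branching threshold) for every `p`. [folklore] -/
theorem half_le_jointCoeff (p : ℚ) : 1 / 2 ≤ p ^ 2 + (1 - p) ^ 2 := by
  nlinarith [sq_nonneg (2 * p - 1)]

/-- … with equality exactly at the fair coin `p = 1/2` (keep-or-swap). [folklore] -/
theorem jointCoeff_eq_half_iff (p : ℚ) : p ^ 2 + (1 - p) ^ 2 = 1 / 2 ↔ p = 1 / 2 := by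
  constructor
  · intro h
    have h2 : (2 * p - 1) ^ 2 = 0 := by nlinarith [h]
    have h3 : 2 * p - 1 = 0 := pow_eq_zero_iff (n := 2) (by norm_num) |>.1 h2
    linarith
  · rintro rfl; norm_num

/-- **No hypothesis on the single-sphere operator can drive a dilution argument**: for every `c > 0`
the family contains a channel with `‖K f‖² = p²‖f‖²`, `p² < c`, `2p < 1`, cross quotient
`1 − p > 1/2`, joint ratio `≥ 1/2`, and zero forgetting (`kspRun_perm`). [folklore] -/
theorem exists_ksp_below (c : ℚ) (hc : 0 < c) :
    ∃ p : ℚ, 0 < p ∧ 2 * p < 1 ∧ p ^ 2 < c ∧ 1 / 2 < 1 - p ∧ 1 / 2 ≤ p ^ 2 + (1 - p) ^ 2 := by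
  refine ⟨min (1 / 4) c, lt_min (by norm_num) hc, ?_, ?_, ?_, half_le_jointCoeff _⟩
  · have := min_le_left (1 / 4 : ℚ) c; linarith
  · have h1 := min_le_left (1 / 4 : ℚ) c
    have h2 := min_le_right (1 / 4 : ℚ) c
    have h0 : 0 < min (1 / 4 : ℚ) c := lt_min (by norm_num) hc
    calc min (1 / 4 : ℚ) c ^ 2 = min (1 / 4) c * min (1 / 4) c := sq _
      _ ≤ (1 / 4) * c := mul_le_mul h1 h2 h0.le (by norm_num)
      _ < c := by linarith
  · have := min_le_left (1 / 4 : ℚ) c; linarith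

end Operators

end Summit.AtomisticToContinuum.HydrodynamicLimit.Theorems.PercolationClosesChaos.Negative
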